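import Literature.Geometry.Kaehler.ComplexTorusIntegralCoLefschetzDegreeThreeCokernel
import Literature.Geometry.Kaehler.ComplexTorusMinimalClasses
import HarnessLib

/-!
# Integral hard Lefschetz in degree one and the co-Lefschetz map on `H³` with the MINIMAL classes:
# `H^{2g−1}(X, ℤ)/γ_{g−1} ∧ H¹(X, ℤ) ≃ ⊕_{a=1}^{g} (ℤ/(d_g/d_a))²` and `H^{2g−1}(X, ℤ)/γ_{g−2} ∧ H³(X, ℤ) ≃ ⊕_{a=1}^{g−1} (ℤ/(d_{g−1}/d_a))²`

Layer `Literature/Geometry/Kaehler`, namespace `Literature.Geometry.Kaehler.ComplexTorus`; lane `lit-hodgefound` (Track 2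
foundations library), seat p09, generation 40, row g40-#5. THEOREMS ONLY (0 definitions); no named fact, net debt 0. Sequel of
g38-#3 `ComplexTorusIntegralCoLefschetzDegreeThreeCokernel` (the cokernels of `θ^{∧(g−1)} ∧ (−) : H¹(X, ℤ) → H^{2g−1}(X, ℤ)` and of the
co-Lefschetz map `θ^{∧(g−2)} ∧ (−) : H³(X, ℤ) → H^{2g−1}(X, ℤ)` as groups: `⊕_x ℤ/((g−1)! ∏_{ν≠a(x)} d_ν)` and `⊕_x ℤ/((g−2)! ∏_{ν∉{a(x),t(a(x))}} d_ν)`;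
`θ^{[g−2]}` onto iff type `(1, …, 1, d_g)`), g35-#1 `ComplexTorusIntegralHardLefschetzDegreeOne` (the index `((g−1)!)^{2g}(d₁⋯d_g)^{2g−2}`) and
g36-#1 `ComplexTorusMinimalClasses` (the content of `θ^{∧q}` is exactly `q!·d₁⋯d_q`; `γ_q = θ^{∧q}/(q!·d₁⋯d_q)` is a primitive integral class).

Sources (the statements being made precise over `ℤ`):

* Lange 2023 §5.4.1 Thm. 5.4.1 (PDF p. 275: hard Lefschetz `L^{g−1} : H¹ ⥲ H^{2g−1}` over `ℂ`) and (5.22); §2.5.3 Thm. 2.5.16 / Cor. 2.5.17 (c)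
  (PDF p. 135); §4.2 Poincaré's formula (PDF p. 204: `[C] = θ^{g−1}/(g−1)!` on a Jacobian); §11.2 (PDF p. 321: the minimal class
  `θ^{g−1}/(g−1)!`); §1.5.1 (PDF p. 51: types); §1.1.3 Exercise 1.1.6 (8);
* Voisin 2002 §6.2.3 Thm. 6.25 (PDF p. 125) and §7.1.2 (PDF p. 134 L31: `L` acts on integral cohomology), §7.2.2 (PDF p. 142 L10);
* Benoist–Debarre 2023 §1 (p. 3): "the minimal cohomology class `θ^c/c! ∈ H^{2c}(X, ℤ)`".

Setting (`g = j + 2`, `θ = ofRealForm η`, symplectic enumeration `e₀` of type `d₁ ∣ ⋯ ∣ d_g` for the Riemann form `η` on `X = E/Φ(ℤ^ι)`; letters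
`x` with index `a(x)`). With the OPTIMAL integral generators `γ_{g−1} = θ^{∧(g−1)}/((g−1)!·d₁⋯d_{g−1})` and `γ_{g−2} = θ^{∧(g−2)}/((g−2)!·d₁⋯d_{g−2})`
of the Lefschetz lines every elementary divisor of g38-#3 is divided by the content, and the products of the `d_ν` collapse to RATIOS:
`(∏_{ν≠a} d_ν)/(d₁⋯d_{g−1}) = d_g/d_a` and `(∏_{ν∉{a,t(a)}} d_ν)/(d₁⋯d_{g−2}) = d_{g−1}/d_a` (`a < g`), `= 1` (`a = g`). Hence

  **`H^{2g−1}(X, ℤ)/γ_{g−1} ∧ H¹(X, ℤ) ≃+ ⊕_x ℤ/(d_g/d_{a(x)}) = ⊕_{a=1}^{g} (ℤ/(d_g/d_a))²`** — integral hard Lefschetz in degree one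
  holds for the minimal class, `γ_{g−1} ∧ (−) : H¹(X, ℤ) ⥲ H^{2g−1}(X, ℤ)`, **iff `d₁ = ⋯ = d_g`**; the index is `∏_a (d_g/d_a)²`;

  **`H^{2g−1}(X, ℤ)/γ_{g−2} ∧ H³(X, ℤ) ≃+ ⊕_{a(x) < g} ℤ/(d_{g−1}/d_{a(x)})`** (the letters of index `g` contribute `0`) — the minimal class
  `γ_{g−2}` maps `H³(X, ℤ)` ONTO `H^{2g−1}(X, ℤ)` **iff `d₁ = ⋯ = d_{g−1}`** (`d_g` arbitrary), refining g38-#3's "`θ^{[g−2]}` is onto iff the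
  type is `(1, …, 1, d_g)`".

## Contents (theorems only; `g = j + 2`)

* §0 (private) arithmetic of a type: `∏_{ν≠a} d_ν = d₁⋯d_{g−1} · (d_g/d_a)`, `(g−2)-fold analogue with `t(a)`, divisibilities; the injectivity
  of multiplication by the content.
* §1 `γ_{g−1}` on `H¹`: **`IsSymplecticEnum.map_wedge_integralForms_one_eq_closure_of_eq_content_smul`** (`γ_{g−1} ∧ H¹(X, ℤ) =
  ⊕_x ℤ (d_g/d_{a(x)}) dx_{(x̄)°}`), **`IsSymplecticEnum.nonempty_addEquiv_quotient_map_wedge_integralForms_one_of_eq_content_smul`**,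
  `…relIndex_map_wedge_integralForms_one_of_eq_content_smul` (`∏_x d_g/d_{a(x)}`), `…relIndex_map_wedge_integralForms_one_eq_sq_of_eq_content_smul`
  (`(∏_a d_g/d_a)²`), **`IsSymplecticEnum.map_wedge_integralForms_one_eq_integralForms_iff_of_eq_content_smul`** (onto iff constant type).
* §2 `γ_{g−2}` on `H³`: **`IsSymplecticEnum.map_wedge_integralForms_three_eq_closure_of_eq_content_smul`**,
  **`IsSymplecticEnum.nonempty_addEquiv_quotient_map_wedge_integralForms_three_of_eq_content_smul`** (`⊕_x ℤ/(d_{g−1}/d_{min(a(x),g−1)})`),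
  `…relIndex_map_wedge_integralForms_three_of_eq_content_smul`,
  **`IsSymplecticEnum.map_wedge_integralForms_three_eq_integralForms_iff_of_eq_content_smul`** (onto iff `d₁ = ⋯ = d_{g−1}`).
* §3 basis-free forms (`IsPolarizationType`, any presentation).

## References

* [cite: Lange2023AbelianVarietiesComplex, §5.4.1 Thm. 5.4.1 and (5.22) (PDF p. 275); §2.5.3 Thm. 2.5.16 and Cor. 2.5.17 (c) (PDF p. 135);
  §4.2 (PDF p. 204); §11.2 (PDF p. 321); §1.5.1 (PDF p. 51); §1.1.3 Exercise 1.1.6 (8)]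
* [cite: VoisinHodgeI2002, §6.2.3 Thm. 6.25 (PDF p. 125); §7.1.2 (PDF p. 134 L31); §7.2.2 (PDF p. 142 L10)]
* [cite: BenoistDebarre2023SmoothSubvarietiesJacobians, §1 (p. 3)]
-/

noncomputable section

open Module Function
open Literature.LinearAlgebra.Alternating

namespace Literature.Geometry.Kaehler.ComplexTorus

section CoLefschetzMinimalClass

variable {ι : Type*} [Fintype ι] [DecidableEq ι] {E : Type*} [NormedAddCommGroup E] [NormedSpace ℂ E]
  (Φ : (ι → ℝ) ≃L[ℝ] E) {j : ℕ} {e₀ : Fin (j + 2) ⊕ Fin (j + 2) ≃ ι} {η : E [⋀^Fin 2]→L[ℝ] ℝ} {d : Fin (j + 2) → ℕ}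

/-! ## §0 Arithmetic of a type; one injectivity -/

omit [Fintype ι] [DecidableEq ι] Φ in
/-- Multiplication by a non-zero natural number is injective on complex forms. [folklore] -/
private theorem nsmulAddMonoidHom_injective₄₀''' {n : ℕ} (N : ℕ) (hN : N ≠ 0) :
    Function.Injective (nsmulAddMonoidHom N : (E [⋀^Fin n]→L[ℝ] ℂ) →+ (E [⋀^Fin n]→L[ℝ] ℂ)) := by
  intro x y hxy
  have h : (N : ℂ) • x = (N : ℂ) • y := by
    rw [Nat.cast_smul_eq_nsmul ℂ N x, Nat.cast_smul_eq_nsmul ℂ N y]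
    exact hxy
  exact smul_right_injective (E [⋀^Fin n]→L[ℝ] ℂ) (Nat.cast_ne_zero.2 hN) h

/-- The order of a quotient given as `Π_k ℤ/e_k` is `∏ e_k`. [folklore] -/
private theorem relIndex_eq_prod_of_nonempty_addEquiv₄₀'' {G : Type*} [AddCommGroup G] {S H : AddSubgroup G} {κ : Type*} [Fintype κ]
    {e : κ → ℕ} (h : Nonempty (↥H ⧸ S.addSubgroupOf H ≃+ ((k : κ) → ZMod (e k)))) : S.relIndex H = ∏ k, e k := by
  classical
  obtain ⟨f⟩ := h
  rw [AddSubgroup.relIndex, AddSubgroup.index, Nat.card_congr f.toEquiv, Nat.card_pi]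
  simp only [Nat.card_zmod]

omit [Fintype ι] [DecidableEq ι] Φ in
/-- **`∏_{ν ≠ a} d_ν = d₁⋯d_{g−1} · (d_g/d_a)`** for a type `d₁ ∣ ⋯ ∣ d_g` (`g = j + 2`): both sides times `d_a` are `d₁⋯d_g`.
[cite: Lange2023AbelianVarietiesComplex, §1.5.1 (PDF p. 51)] -/
private theorem prod_compl_singleton_eq_mul_div₄₀ (hd : ∀ i i' : Fin (j + 2), i ≤ i' → d i ∣ d i') (hp : ∀ i, 0 < d i)
    (hle₁ : j + 1 ≤ j + 2) (a : Fin (j + 2)) :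
    ∏ ν ∈ ({a} : Finset (Fin (j + 2)))ᶜ, d ν = (∏ i : Fin (j + 1), d (Fin.castLE hle₁ i)) * (d (Fin.last (j + 1)) / d a) := by
  obtain ⟨q, hq⟩ := hd a (Fin.last (j + 1)) (Fin.le_last a)
  have h1 := Finset.prod_compl_mul_prod ({a} : Finset (Fin (j + 2))) d
  rw [Finset.prod_singleton, Fin.prod_univ_castSucc, hq] at h1
  have hcs : ∏ i : Fin (j + 1), d (Fin.castLE hle₁ i) = ∏ i : Fin (j + 1), d i.castSucc :=
    Finset.prod_congr rfl fun i _ ↦ congrArg d (Fin.ext rfl)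
  rw [hcs, hq, Nat.mul_div_cancel_left q (hp a)]
  refine Nat.eq_of_mul_eq_mul_right (hp a) ?_
  rw [h1]
  ring

omit [Fintype ι] [DecidableEq ι] Φ in
/-- `d_{min(a, g−1)} ∣ d_{g−1}` for a type (`g = j + 2`; `min(a, g−1)` written as `if a = g then g−1 else a`). [cite: Lange2023AbelianVarietiesComplex, §1.5.1 (PDF p. 51)] -/
private theorem apply_ite_dvd_apply_castSucc_last₄₀ (hd : ∀ i i' : Fin (j + 2), i ≤ i' → d i ∣ d i') (a : Fin (j + 2)) :
    d (if a = Fin.last (j + 1) then ((Fin.last j).castSucc : Fin (j + 2)) else a) ∣ d ((Fin.last j).castSucc) := by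
  by_cases ha : a = Fin.last (j + 1)
  · rw [if_pos ha]
  · rw [if_neg ha]
    refine hd _ _ (Fin.le_def.2 ?_)
    have hne : (a : ℕ) ≠ j + 1 := fun h' ↦ ha (Fin.ext (by rw [h', Fin.val_last]))
    rw [Fin.val_castSucc, Fin.val_last]
    omega

omit [Fintype ι] [DecidableEq ι] Φ in
/-- **`∏_{ν ∉ {a, t(a)}} d_ν = d₁⋯d_{g−2} · (d_{g−1}/d_{min(a, g−1)})`** (`g = j + 2`; `t(a)` the largest index `≠ a`): both sides times
`d_a d_{t(a)}` are `d₁⋯d_g`. [cite: Lange2023AbelianVarietiesComplex, §1.5.1 (PDF p. 51)] -/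
private theorem prod_compl_pair_eq_mul_div₄₀ (hd : ∀ i i' : Fin (j + 2), i ≤ i' → d i ∣ d i') (hp : ∀ i, 0 < d i)
    (hle₂ : j ≤ j + 2) (a : Fin (j + 2)) :
    ∏ ν ∈ ({a, if a = Fin.last (j + 1) then ((Fin.last j).castSucc : Fin (j + 2)) else Fin.last (j + 1)} : Finset (Fin (j + 2)))ᶜ, d ν =
      (∏ i : Fin j, d (Fin.castLE hle₂ i)) *
        (d ((Fin.last j).castSucc) / d (if a = Fin.last (j + 1) then ((Fin.last j).castSucc : Fin (j + 2)) else a)) := by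
  have hcs : ∏ i : Fin j, d (Fin.castLE hle₂ i) = ∏ i : Fin j, d i.castSucc.castSucc :=
    Finset.prod_congr rfl fun i _ ↦ congrArg d (Fin.ext rfl)
  have hjl : ((Fin.last j).castSucc : Fin (j + 2)) ≠ Fin.last (j + 1) := (Fin.castSucc_lt_last _).ne
  by_cases ha : a = Fin.last (j + 1)
  · rw [if_pos ha, if_pos ha, ha, Nat.div_self (hp _), mul_one, hcs]
    have h1 := Finset.prod_compl_mul_prod ({Fin.last (j + 1), ((Fin.last j).castSucc : Fin (j + 2))} : Finset (Fin (j + 2))) d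
    rw [Finset.prod_pair hjl.symm, Fin.prod_univ_castSucc, Fin.prod_univ_castSucc] at h1
    refine Nat.eq_of_mul_eq_mul_right (Nat.mul_pos (hp (Fin.last (j + 1))) (hp ((Fin.last j).castSucc))) ?_
    rw [h1]
    ring
  · rw [if_neg ha, if_neg ha, hcs]
    have hale : a ≤ ((Fin.last j).castSucc : Fin (j + 2)) := by
      refine Fin.le_def.2 ?_
      have hne : (a : ℕ) ≠ j + 1 := fun h' ↦ ha (Fin.ext (by rw [h', Fin.val_last]))
      rw [Fin.val_castSucc, Fin.val_last]
      omega
    obtain ⟨q, hq⟩ := hd _ _ hale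
    have h1 := Finset.prod_compl_mul_prod ({a, Fin.last (j + 1)} : Finset (Fin (j + 2))) d
    rw [Finset.prod_pair ha, Fin.prod_univ_castSucc, Fin.prod_univ_castSucc, hq] at h1
    rw [hq, Nat.mul_div_cancel_left q (hp a)]
    refine Nat.eq_of_mul_eq_mul_right (Nat.mul_pos (hp a) (hp (Fin.last (j + 1)))) ?_
    rw [h1]
    ring

/-! ## §1 The minimal class `γ_{g−1}` on `H¹(X, ℤ)`: `H^{2g−1}(X, ℤ)/γ_{g−1} ∧ H¹(X, ℤ) ≃+ ⊕_x ℤ/(d_g/d_{a(x)})` -/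

/-- **`γ_{g−1} ∧ H¹(X, ℤ) = ⊕_x ℤ · (d_g/d_{a(x)}) · dx_{(x̄)°}`** in the basis `(dx_{(x̄)°})_x` of `H^{2g−1}(X, ℤ)` (`g = j + 2`; `m` any form with
`θ^{∧(g−1)} = ((g−1)!·d₁⋯d_{g−1}) · m`): `θ^{∧(g−1)} ∧ H¹(X, ℤ) = ⊕_x ℤ (g−1)! (∏_{ν≠a(x)} d_ν) dx_{(x̄)°}` (g37-#1 §4, re-bracketed as in g38-#3 §2),
`(g−1)! ∏_{ν≠a} d_ν = ((g−1)!·d₁⋯d_{g−1}) · (d_g/d_a)`, and multiplication by the content is injective.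
[cite: Lange2023AbelianVarietiesComplex, §2.5.3 Cor. 2.5.17 (c) (PDF p. 135); §5.4.1 Thm. 5.4.1 and (5.22) (PDF p. 275); §1.5.1 (PDF p. 51); §1.1.3 Exercise 1.1.6 (8)] [cite: VoisinHodgeI2002, §7.2.2 (PDF p. 142 L10)] [cite: BenoistDebarre2023SmoothSubvarietiesJacobians, §1 (p. 3)] -/
theorem IsSymplecticEnum.map_wedge_integralForms_one_eq_closure_of_eq_content_smul [LinearOrder ι] (h : IsSymplecticEnum Φ e₀ η d)
    (hη : IsRiemannForm Φ η) (hkl : (2 * j + 3) + 1 = Fintype.card ι) (hle₁ : j + 1 ≤ j + 2) {m : E [⋀^Fin (2 * (j + 1))]→L[ℝ] ℂ}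
    (hm : wedgePow (ofRealForm η) (j + 1) = (((j + 1).factorial * ∏ i : Fin (j + 1), d (Fin.castLE hle₁ i) : ℕ) : ℂ) • m) :
    (integralForms Φ 1).map (AddMonoidHom.mk'
        (fun x : E [⋀^Fin 1]→L[ℝ] ℂ ↦ (m.wedge x : E [⋀^Fin (2 * j + 3)]→L[ℝ] ℂ)) (ContinuousAlternatingMap.wedge_add_right _)) =
      AddSubgroup.closure (Set.range fun x : Fin (j + 2) ⊕ Fin (j + 2) ↦
        ((d (Fin.last (j + 1)) / d (Sum.elim id id x) : ℕ) : ℤ) •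
          latMonomial Φ (2 * j + 3) (complWord hkl ⟨fun _ : Fin 1 ↦ e₀ x.swap, Subsingleton.strictMono _⟩).1) := by
  classical
  have hP : 0 < ∏ i : Fin (j + 1), d (Fin.castLE hle₁ i) := Finset.prod_pos fun i _ ↦ h.pos hη _
  have hD : (j + 1).factorial * ∏ i : Fin (j + 1), d (Fin.castLE hle₁ i) ≠ 0 := (Nat.mul_pos (Nat.factorial_pos _) hP).ne'
  have hcomp : (nsmulAddMonoidHom ((j + 1).factorial * ∏ i : Fin (j + 1), d (Fin.castLE hle₁ i)) :
      (E [⋀^Fin (2 * j + 3)]→L[ℝ] ℂ) →+ (E [⋀^Fin (2 * j + 3)]→L[ℝ] ℂ)).comp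
      (AddMonoidHom.mk' (fun x : E [⋀^Fin 1]→L[ℝ] ℂ ↦ (m.wedge x : E [⋀^Fin (2 * j + 3)]→L[ℝ] ℂ))
        (ContinuousAlternatingMap.wedge_add_right _)) = AddMonoidHom.mk' (fun x : E [⋀^Fin 1]→L[ℝ] ℂ ↦
        ((wedgePow (ofRealForm η) (j + 1)).wedge x : E [⋀^Fin (2 * j + 3)]→L[ℝ] ℂ)) (ContinuousAlternatingMap.wedge_add_right _) := by
    refine AddMonoidHom.ext fun x ↦ ?_
    rw [AddMonoidHom.comp_apply, AddMonoidHom.mk'_apply, AddMonoidHom.mk'_apply, nsmulAddMonoidHom_apply, hm, wedge_smul_left_complex]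
    exact (Nat.cast_smul_eq_nsmul ℂ ((j + 1).factorial * ∏ i : Fin (j + 1), d (Fin.castLE hle₁ i)) (m.wedge x)).symm
  refine AddSubgroup.map_injective (nsmulAddMonoidHom_injective₄₀''' (n := 2 * j + 3) _ hD) ?_
  change AddSubgroup.map _ (AddSubgroup.map _ _) = AddSubgroup.map _ (AddSubgroup.closure _)
  rw [AddSubgroup.map_map, hcomp, ← map_wedgePow_wedge_map_wedge_integralForms_one_eq_map_wedgePow_succ_wedge Φ,
    h.map_wedgePow_wedge_wedge_integralForms_one_eq_closure Φ hkl, AddMonoidHom.map_closure, ← Set.range_comp]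
  refine congrArg AddSubgroup.closure (congrArg Set.range (funext fun x ↦ ?_))
  rw [Function.comp_apply, nsmulAddMonoidHom_apply, ← natCast_zsmul, smul_smul]
  congr 1
  rw [prod_compl_singleton_eq_mul_div₄₀ h.dvd (h.pos hη) hle₁ (Sum.elim id id x)]
  push_cast
  ring

/-- **Integral hard Lefschetz in degree one with the minimal class, as a group.** Let `η` be a Riemann form of type `(d₁, …, d_g)` on
`X = E/Φ(ℤ^ι)` with a symplectic enumeration (`g = j + 2`, `θ = ofRealForm η`) and `m` any form with `θ^{∧(g−1)} = ((g−1)!·d₁⋯d_{g−1}) · m` — the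
minimal class `γ_{g−1}`, a primitive integral class for every type (`ComplexTorusMinimalClasses`; on a Jacobian the class of the curve,
Poincaré's formula). The optimal integral Lefschetz map `γ_{g−1} ∧ (−) : H¹(X, ℤ) → H^{2g−1}(X, ℤ)` is injective with cokernel

  **`H^{2g−1}(X, ℤ)/γ_{g−1} ∧ H¹(X, ℤ) ≃+ ⊕_x ℤ/(d_g/d_{a(x)}) = ⊕_{a=1}^{g} (ℤ/(d_g/d_a))²`**

(over the `2g` letters `x`, `a(x)` the index of `x`): every elementary divisor `(g−1)! ∏_{ν≠a(x)} d_ν` of `θ^{∧(g−1)} ∧ H¹(X, ℤ)` (g38-#3 §2)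
divided by the content `(g−1)!·d₁⋯d_{g−1}` is the RATIO `d_g/d_{a(x)}`. Trivial iff `d₁ = ⋯ = d_g` (below).
[cite: Lange2023AbelianVarietiesComplex, §5.4.1 Thm. 5.4.1 and (5.22) (PDF p. 275); §2.5.3 Cor. 2.5.17 (c) (PDF p. 135); §4.2 (PDF p. 204); §11.2 (PDF p. 321); §1.5.1 (PDF p. 51)] [cite: VoisinHodgeI2002, §6.2.3 Thm. 6.25 (PDF p. 125); §7.2.2 (PDF p. 142 L10)] [cite: BenoistDebarre2023SmoothSubvarietiesJacobians, §1 (p. 3)] -/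
theorem IsSymplecticEnum.nonempty_addEquiv_quotient_map_wedge_integralForms_one_of_eq_content_smul (h : IsSymplecticEnum Φ e₀ η d)
    (hη : IsRiemannForm Φ η) (hle₁ : j + 1 ≤ j + 2) {m : E [⋀^Fin (2 * (j + 1))]→L[ℝ] ℂ}
    (hm : wedgePow (ofRealForm η) (j + 1) = (((j + 1).factorial * ∏ i : Fin (j + 1), d (Fin.castLE hle₁ i) : ℕ) : ℂ) • m) :
    Nonempty (↥(integralForms Φ (2 * j + 3)) ⧸ ((integralForms Φ 1).map (AddMonoidHom.mk'
        (fun x : E [⋀^Fin 1]→L[ℝ] ℂ ↦ (m.wedge x : E [⋀^Fin (2 * j + 3)]→L[ℝ] ℂ))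
        (ContinuousAlternatingMap.wedge_add_right _))).addSubgroupOf (integralForms Φ (2 * j + 3)) ≃+
      ((x : Fin (j + 2) ⊕ Fin (j + 2)) → ZMod (d (Fin.last (j + 1)) / d (Sum.elim id id x)))) := by
  classical
  have hn : 1 + (2 * j + 3) = 2 * (j + 2) := by ring
  have hkl : (2 * j + 3) + 1 = Fintype.card ι := lk_eq_card (ilvEnum e₀) hn
  letI : LinearOrder ι := linearOrderOfOrientation (ilvEnum e₀)
  obtain ⟨b, hb⟩ := exists_basis_integralForms_coe_eq_latMonomial_complWord Φ e₀ hkl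
  refine nonempty_addEquiv_quotient_pi_zmod_of_basis b _
    (fun x ↦ Nat.div_pos (Nat.le_of_dvd (h.pos hη _) (h.dvd _ _ (Fin.le_last _))) (h.pos hη _))
    ((h.map_wedge_integralForms_one_eq_closure_of_eq_content_smul Φ hη hkl hle₁ hm).trans
      (congrArg AddSubgroup.closure (congrArg Set.range (funext fun x ↦ by rw [hb]))))

/-- **The index `[H^{2g−1}(X, ℤ) : γ_{g−1} ∧ H¹(X, ℤ)] = ∏_x d_g/d_{a(x)}`** (`g = j + 2`) — compare `((g−1)!)^{2g} (d₁⋯d_g)^{2g−2}` for `θ^{∧(g−1)}`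
(g35-#1). [cite: Lange2023AbelianVarietiesComplex, §5.4.1 Thm. 5.4.1 (PDF p. 275); §2.5.3 Cor. 2.5.17 (c) (PDF p. 135); §1.1.3 Exercise 1.1.6 (8)] [cite: VoisinHodgeI2002, §7.2.2 (PDF p. 142 L10)] -/
theorem IsSymplecticEnum.relIndex_map_wedge_integralForms_one_of_eq_content_smul (h : IsSymplecticEnum Φ e₀ η d)
    (hη : IsRiemannForm Φ η) (hle₁ : j + 1 ≤ j + 2) {m : E [⋀^Fin (2 * (j + 1))]→L[ℝ] ℂ}
    (hm : wedgePow (ofRealForm η) (j + 1) = (((j + 1).factorial * ∏ i : Fin (j + 1), d (Fin.castLE hle₁ i) : ℕ) : ℂ) • m) :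
    ((integralForms Φ 1).map (AddMonoidHom.mk'
        (fun x : E [⋀^Fin 1]→L[ℝ] ℂ ↦ (m.wedge x : E [⋀^Fin (2 * j + 3)]→L[ℝ] ℂ))
        (ContinuousAlternatingMap.wedge_add_right _))).relIndex (integralForms Φ (2 * j + 3)) =
      ∏ x : Fin (j + 2) ⊕ Fin (j + 2), (d (Fin.last (j + 1)) / d (Sum.elim id id x)) :=
  relIndex_eq_prod_of_nonempty_addEquiv₄₀'' (h.nonempty_addEquiv_quotient_map_wedge_integralForms_one_of_eq_content_smul Φ hη hle₁ hm)

/-- **`[H^{2g−1}(X, ℤ) : γ_{g−1} ∧ H¹(X, ℤ)] = (∏_{a=1}^{g} d_g/d_a)²`** — each index `a` carries the two letters `λ_a`, `μ_a`.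
[cite: Lange2023AbelianVarietiesComplex, §5.4.1 Thm. 5.4.1 (PDF p. 275); §2.5.3 Cor. 2.5.17 (c) (PDF p. 135)] [cite: VoisinHodgeI2002, §7.2.2 (PDF p. 142 L10)] -/
theorem IsSymplecticEnum.relIndex_map_wedge_integralForms_one_eq_sq_of_eq_content_smul (h : IsSymplecticEnum Φ e₀ η d)
    (hη : IsRiemannForm Φ η) (hle₁ : j + 1 ≤ j + 2) {m : E [⋀^Fin (2 * (j + 1))]→L[ℝ] ℂ}
    (hm : wedgePow (ofRealForm η) (j + 1) = (((j + 1).factorial * ∏ i : Fin (j + 1), d (Fin.castLE hle₁ i) : ℕ) : ℂ) • m) :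
    ((integralForms Φ 1).map (AddMonoidHom.mk'
        (fun x : E [⋀^Fin 1]→L[ℝ] ℂ ↦ (m.wedge x : E [⋀^Fin (2 * j + 3)]→L[ℝ] ℂ))
        (ContinuousAlternatingMap.wedge_add_right _))).relIndex (integralForms Φ (2 * j + 3)) =
      (∏ a : Fin (j + 2), (d (Fin.last (j + 1)) / d a)) ^ 2 := by
  rw [h.relIndex_map_wedge_integralForms_one_of_eq_content_smul Φ hη hle₁ hm, Fintype.prod_sum_type, sq]
  simp only [Sum.elim_inl, Sum.elim_inr, id_eq]

/-- **Integral hard Lefschetz in degree one with the minimal class HOLDS iff the type is constant**: `γ_{g−1} ∧ H¹(X, ℤ) = H^{2g−1}(X, ℤ)`,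
i.e. `γ_{g−1} ∧ (−) : H¹(X, ℤ) ⥲ H^{2g−1}(X, ℤ)` is an isomorphism of lattices, **iff `d₁ = ⋯ = d_g`** (`g = j + 2`; the elementary divisor at the
letters of index `a` is `d_g/d_a`). For a principal polarisation this is Poincaré's formula over `ℤ` (`θ^{[g−1]} ∧ H¹(X, ℤ) = H^{2g−1}(X, ℤ)`,
g35-#1); for the non-constant types even the optimal class fails, by `∏_a (d_g/d_a)²`.
[cite: Lange2023AbelianVarietiesComplex, §5.4.1 Thm. 5.4.1 and (5.22) (PDF p. 275); §4.2 (PDF p. 204); §11.2 (PDF p. 321); §1.5.1 (PDF p. 51); §2.1.1] [cite: VoisinHodgeI2002, §6.2.3 Thm. 6.25 (PDF p. 125); §7.2.2 (PDF p. 142 L10)] [cite: BenoistDebarre2023SmoothSubvarietiesJacobians, §1 (p. 3)] -/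
theorem IsSymplecticEnum.map_wedge_integralForms_one_eq_integralForms_iff_of_eq_content_smul (h : IsSymplecticEnum Φ e₀ η d)
    (hη : IsRiemannForm Φ η) (hle₁ : j + 1 ≤ j + 2) {m : E [⋀^Fin (2 * (j + 1))]→L[ℝ] ℂ}
    (hm : wedgePow (ofRealForm η) (j + 1) = (((j + 1).factorial * ∏ i : Fin (j + 1), d (Fin.castLE hle₁ i) : ℕ) : ℂ) • m) :
    (integralForms Φ 1).map (AddMonoidHom.mk'
        (fun x : E [⋀^Fin 1]→L[ℝ] ℂ ↦ (m.wedge x : E [⋀^Fin (2 * j + 3)]→L[ℝ] ℂ))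
        (ContinuousAlternatingMap.wedge_add_right _)) = integralForms Φ (2 * j + 3) ↔ ∀ i, d i = d 0 := by
  classical
  have hn : 1 + (2 * j + 3) = 2 * (j + 2) := by ring
  have hkl : (2 * j + 3) + 1 = Fintype.card ι := lk_eq_card (ilvEnum e₀) hn
  letI : LinearOrder ι := linearOrderOfOrientation (ilvEnum e₀)
  constructor
  · intro heq i
    have hidx := h.relIndex_map_wedge_integralForms_one_of_eq_content_smul Φ hη hle₁ hm
    rw [heq, AddSubgroup.relIndex_self] at hidx
    -- every elementary divisor `d_g/d_a` is `1`, so `d_a = d_g` for all `a`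
    have hone : ∀ a : Fin (j + 2), d a = d (Fin.last (j + 1)) := fun a ↦ by
      have hdvd1 := Finset.dvd_prod_of_mem (fun x : Fin (j + 2) ⊕ Fin (j + 2) ↦ d (Fin.last (j + 1)) / d (Sum.elim id id x))
        (Finset.mem_univ (Sum.inl a : Fin (j + 2) ⊕ Fin (j + 2)))
      rw [← hidx] at hdvd1
      have h1 : d (Fin.last (j + 1)) / d a = 1 := Nat.dvd_one.1 hdvd1
      obtain ⟨q, hq⟩ := h.dvd a (Fin.last (j + 1)) (Fin.le_last a)
      rw [hq, Nat.mul_div_cancel_left q (h.pos hη a)] at h1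
      rw [hq, h1, mul_one]
    rw [hone i, hone 0]
  · intro hd
    obtain ⟨b, hb⟩ := exists_basis_integralForms_coe_eq_latMonomial_complWord Φ e₀ hkl
    rw [h.map_wedge_integralForms_one_eq_closure_of_eq_content_smul Φ hη hkl hle₁ hm]
    refine Eq.trans (congrArg AddSubgroup.closure (congrArg Set.range (funext fun x ↦ ?_))) (closure_range_coe_basis_eq b)
    rw [hb, hd (Fin.last (j + 1)), hd (Sum.elim id id x), Nat.div_self (h.pos hη 0), Nat.cast_one, one_zsmul]

/-! ## §2 The minimal class `γ_{g−2}` on `H³(X, ℤ)` (the co-Lefschetz map): `H^{2g−1}(X, ℤ)/γ_{g−2} ∧ H³(X, ℤ) ≃+ ⊕_{a(x)<g} ℤ/(d_{g−1}/d_{a(x)})` -/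

/-- **`γ_{g−2} ∧ H³(X, ℤ) = ⊕_x ℤ · (d_{g−1}/d_{min(a(x), g−1)}) · dx_{(x̄)°}`** in the basis `(dx_{(x̄)°})_x` of `H^{2g−1}(X, ℤ)` (`g = j + 2`; `γ` any form with
`θ^{∧(g−2)} = ((g−2)!·d₁⋯d_{g−2}) · γ`; `min(a, g−1)` is written `if a = g then g−1 else a`): the elementary divisors
`(g−2)! ∏_{ν∉{a(x),t(a(x))}} d_ν` of `θ^{∧(g−2)} ∧ H³(X, ℤ)` (g37-#1 §3) divided by the content are `d_{g−1}/d_{a(x)}` for `a(x) < g` and `1` for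
`a(x) = g`. [cite: Lange2023AbelianVarietiesComplex, §2.5.3 Thm. 2.5.16 (PDF p. 135); §5.4.1 Thm. 5.4.1 and (5.22) (PDF p. 275); §1.5.1 (PDF p. 51); §1.1.3 Exercise 1.1.6 (8)] [cite: VoisinHodgeI2002, §7.1.2 (PDF p. 134 L31)] [cite: BenoistDebarre2023SmoothSubvarietiesJacobians, §1 (p. 3)] -/
theorem IsSymplecticEnum.map_wedge_integralForms_three_eq_closure_of_eq_content_smul [LinearOrder ι] (h : IsSymplecticEnum Φ e₀ η d)
    (hη : IsRiemannForm Φ η) (hkl : (2 * j + 3) + 1 = Fintype.card ι) (hle₂ : j ≤ j + 2) {γ : E [⋀^Fin (2 * j)]→L[ℝ] ℂ}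
    (hγ : wedgePow (ofRealForm η) j = ((j.factorial * ∏ i : Fin j, d (Fin.castLE hle₂ i) : ℕ) : ℂ) • γ) :
    (integralForms Φ 3).map (AddMonoidHom.mk'
        (fun x : E [⋀^Fin 3]→L[ℝ] ℂ ↦ γ.wedge x) (ContinuousAlternatingMap.wedge_add_right _)) =
      AddSubgroup.closure (Set.range fun x : Fin (j + 2) ⊕ Fin (j + 2) ↦
        ((d ((Fin.last j).castSucc) / d (if Sum.elim id id x = Fin.last (j + 1) then ((Fin.last j).castSucc : Fin (j + 2))
            else Sum.elim id id x) : ℕ) : ℤ) •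
          latMonomial Φ (2 * j + 3) (complWord hkl ⟨fun _ : Fin 1 ↦ e₀ x.swap, Subsingleton.strictMono _⟩).1) := by
  classical
  have hP : 0 < ∏ i : Fin j, d (Fin.castLE hle₂ i) := Finset.prod_pos fun i _ ↦ h.pos hη _
  have hD : j.factorial * ∏ i : Fin j, d (Fin.castLE hle₂ i) ≠ 0 := (Nat.mul_pos (Nat.factorial_pos _) hP).ne'
  have hcomp : (nsmulAddMonoidHom (j.factorial * ∏ i : Fin j, d (Fin.castLE hle₂ i)) :
      (E [⋀^Fin (2 * j + 3)]→L[ℝ] ℂ) →+ (E [⋀^Fin (2 * j + 3)]→L[ℝ] ℂ)).comp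
      (AddMonoidHom.mk' (fun x : E [⋀^Fin 3]→L[ℝ] ℂ ↦ γ.wedge x) (ContinuousAlternatingMap.wedge_add_right _)) =
      AddMonoidHom.mk' (fun x : E [⋀^Fin 3]→L[ℝ] ℂ ↦ (wedgePow (ofRealForm η) j).wedge x) (ContinuousAlternatingMap.wedge_add_right _) := by
    refine AddMonoidHom.ext fun x ↦ ?_
    rw [AddMonoidHom.comp_apply, AddMonoidHom.mk'_apply, AddMonoidHom.mk'_apply, nsmulAddMonoidHom_apply, hγ, wedge_smul_left_complex]
    exact (Nat.cast_smul_eq_nsmul ℂ (j.factorial * ∏ i : Fin j, d (Fin.castLE hle₂ i)) (γ.wedge x)).symm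
  refine AddSubgroup.map_injective (nsmulAddMonoidHom_injective₄₀''' (n := 2 * j + 3) _ hD) ?_
  change AddSubgroup.map _ (AddSubgroup.map _ _) = AddSubgroup.map _ (AddSubgroup.closure _)
  rw [AddSubgroup.map_map, hcomp, h.map_wedgePow_wedge_integralForms_three_eq_closure Φ hkl, AddMonoidHom.map_closure, ← Set.range_comp]
  refine congrArg AddSubgroup.closure (congrArg Set.range (funext fun x ↦ ?_))
  rw [Function.comp_apply, nsmulAddMonoidHom_apply, ← natCast_zsmul, smul_smul]
  congr 1
  rw [prod_compl_pair_eq_mul_div₄₀ h.dvd (h.pos hη) hle₂ (Sum.elim id id x)]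
  push_cast
  ring

/-- **The co-Lefschetz map of the minimal class `γ_{g−2}` on `H³(X, ℤ)`, as a group**: for a Riemann form of type `(d₁, …, d_g)` with a
symplectic enumeration (`g = j + 2`) and any form `γ` with `θ^{∧(g−2)} = ((g−2)!·d₁⋯d_{g−2}) · γ`,

  **`H^{2g−1}(X, ℤ)/γ_{g−2} ∧ H³(X, ℤ) ≃+ ⊕_x ℤ/(d_{g−1}/d_{min(a(x), g−1)}) = ⊕_{a=1}^{g−1} (ℤ/(d_{g−1}/d_a))²`**

(the letters of index `g` contribute trivial factors): the elementary divisors `(g−2)! ∏_{ν∉{a(x),t(a(x))}} d_ν` of g38-#3 §1 divided by the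
content. A group in which `d_g` does not occur; trivial iff `d₁ = ⋯ = d_{g−1}` (below).
[cite: Lange2023AbelianVarietiesComplex, §5.4.1 Thm. 5.4.1 and (5.22) (PDF p. 275); §2.5.3 Thm. 2.5.16, Cor. 2.5.17 (PDF p. 135); §4.2 (PDF p. 204); §1.5.1 (PDF p. 51)] [cite: VoisinHodgeI2002, §6.2.3 Thm. 6.25 (PDF p. 125); §7.1.2 (PDF p. 134 L31)] [cite: BenoistDebarre2023SmoothSubvarietiesJacobians, §1 (p. 3)] -/
theorem IsSymplecticEnum.nonempty_addEquiv_quotient_map_wedge_integralForms_three_of_eq_content_smul (h : IsSymplecticEnum Φ e₀ η d)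
    (hη : IsRiemannForm Φ η) (hle₂ : j ≤ j + 2) {γ : E [⋀^Fin (2 * j)]→L[ℝ] ℂ}
    (hγ : wedgePow (ofRealForm η) j = ((j.factorial * ∏ i : Fin j, d (Fin.castLE hle₂ i) : ℕ) : ℂ) • γ) :
    Nonempty (↥(integralForms Φ (2 * j + 3)) ⧸ ((integralForms Φ 3).map (AddMonoidHom.mk'
        (fun x : E [⋀^Fin 3]→L[ℝ] ℂ ↦ γ.wedge x) (ContinuousAlternatingMap.wedge_add_right _))).addSubgroupOf (integralForms Φ (2 * j + 3)) ≃+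
      ((x : Fin (j + 2) ⊕ Fin (j + 2)) → ZMod (d ((Fin.last j).castSucc) /
        d (if Sum.elim id id x = Fin.last (j + 1) then ((Fin.last j).castSucc : Fin (j + 2)) else Sum.elim id id x)))) := by
  classical
  have hn : 1 + (2 * j + 3) = 2 * (j + 2) := by ring
  have hkl : (2 * j + 3) + 1 = Fintype.card ι := lk_eq_card (ilvEnum e₀) hn
  letI : LinearOrder ι := linearOrderOfOrientation (ilvEnum e₀)
  obtain ⟨b, hb⟩ := exists_basis_integralForms_coe_eq_latMonomial_complWord Φ e₀ hkl
  refine nonempty_addEquiv_quotient_pi_zmod_of_basis b _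
    (fun x ↦ Nat.div_pos (Nat.le_of_dvd (h.pos hη _) (apply_ite_dvd_apply_castSucc_last₄₀ h.dvd _)) (h.pos hη _))
    ((h.map_wedge_integralForms_three_eq_closure_of_eq_content_smul Φ hη hkl hle₂ hγ).trans
      (congrArg AddSubgroup.closure (congrArg Set.range (funext fun x ↦ by rw [hb]))))

/-- **The index `[H^{2g−1}(X, ℤ) : γ_{g−2} ∧ H³(X, ℤ)] = ∏_x d_{g−1}/d_{min(a(x), g−1)}`** (`g = j + 2`) — compare
`∏_x (g−2)! ∏_{ν∉{a(x),t(a(x))}} d_ν` for `θ^{∧(g−2)}` (g37-#1). [cite: Lange2023AbelianVarietiesComplex, §5.4.1 Thm. 5.4.1 (PDF p. 275); §2.5.3 Thm. 2.5.16 (PDF p. 135); §1.1.3 Exercise 1.1.6 (8)] [cite: VoisinHodgeI2002, §7.1.2 (PDF p. 134 L31)] -/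
theorem IsSymplecticEnum.relIndex_map_wedge_integralForms_three_of_eq_content_smul (h : IsSymplecticEnum Φ e₀ η d)
    (hη : IsRiemannForm Φ η) (hle₂ : j ≤ j + 2) {γ : E [⋀^Fin (2 * j)]→L[ℝ] ℂ}
    (hγ : wedgePow (ofRealForm η) j = ((j.factorial * ∏ i : Fin j, d (Fin.castLE hle₂ i) : ℕ) : ℂ) • γ) :
    ((integralForms Φ 3).map (AddMonoidHom.mk'
        (fun x : E [⋀^Fin 3]→L[ℝ] ℂ ↦ γ.wedge x) (ContinuousAlternatingMap.wedge_add_right _))).relIndex (integralForms Φ (2 * j + 3)) =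
      ∏ x : Fin (j + 2) ⊕ Fin (j + 2), (d ((Fin.last j).castSucc) /
        d (if Sum.elim id id x = Fin.last (j + 1) then ((Fin.last j).castSucc : Fin (j + 2)) else Sum.elim id id x)) :=
  relIndex_eq_prod_of_nonempty_addEquiv₄₀'' (h.nonempty_addEquiv_quotient_map_wedge_integralForms_three_of_eq_content_smul Φ hη hle₂ hγ)

/-- **The minimal class `γ_{g−2}` maps `H³(X, ℤ)` ONTO `H^{2g−1}(X, ℤ)` iff `d₁ = ⋯ = d_{g−1}`** (`g = j + 2`; `d_g` is arbitrary: the co-Lefschetz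
cokernel never sees `d_g`). This refines g38-#3's criterion for the divided power `θ^{[g−2]} = d₁⋯d_{g−2} · γ_{g−2}` (onto iff type `(1, …, 1, d_g)`).
[cite: Lange2023AbelianVarietiesComplex, §5.4.1 Thm. 5.4.1 and (5.22) (PDF p. 275); §2.5.3 Thm. 2.5.16 (PDF p. 135); §4.2 (PDF p. 204); §1.5.1 (PDF p. 51)] [cite: VoisinHodgeI2002, §7.1.2 (PDF p. 134 L31)] [cite: BenoistDebarre2023SmoothSubvarietiesJacobians, §1 (p. 3)] -/
theorem IsSymplecticEnum.map_wedge_integralForms_three_eq_integralForms_iff_of_eq_content_smul (h : IsSymplecticEnum Φ e₀ η d)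
    (hη : IsRiemannForm Φ η) (hle₂ : j ≤ j + 2) {γ : E [⋀^Fin (2 * j)]→L[ℝ] ℂ}
    (hγ : wedgePow (ofRealForm η) j = ((j.factorial * ∏ i : Fin j, d (Fin.castLE hle₂ i) : ℕ) : ℂ) • γ) :
    (integralForms Φ 3).map (AddMonoidHom.mk'
        (fun x : E [⋀^Fin 3]→L[ℝ] ℂ ↦ γ.wedge x) (ContinuousAlternatingMap.wedge_add_right _)) = integralForms Φ (2 * j + 3) ↔
      ∀ i : Fin (j + 1), d i.castSucc = d 0 := by
  classical
  have hn : 1 + (2 * j + 3) = 2 * (j + 2) := by ring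
  have hkl : (2 * j + 3) + 1 = Fintype.card ι := lk_eq_card (ilvEnum e₀) hn
  letI : LinearOrder ι := linearOrderOfOrientation (ilvEnum e₀)
  have hcs_ne : ∀ i : Fin (j + 1), (i.castSucc : Fin (j + 2)) ≠ Fin.last (j + 1) := fun i ↦ (Fin.castSucc_lt_last i).ne
  constructor
  · intro heq
    have hidx := h.relIndex_map_wedge_integralForms_three_of_eq_content_smul Φ hη hle₂ hγ
    rw [heq, AddSubgroup.relIndex_self] at hidx
    -- every elementary divisor `d_{g−1}/d_a`, `a < g`, is `1`
    have hone : ∀ i : Fin (j + 1), d i.castSucc = d ((Fin.last j).castSucc) := fun i ↦ by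
      have hdvd1 := Finset.dvd_prod_of_mem (fun x : Fin (j + 2) ⊕ Fin (j + 2) ↦ d ((Fin.last j).castSucc) /
          d (if Sum.elim id id x = Fin.last (j + 1) then ((Fin.last j).castSucc : Fin (j + 2)) else Sum.elim id id x))
        (Finset.mem_univ (Sum.inl (i.castSucc) : Fin (j + 2) ⊕ Fin (j + 2)))
      rw [← hidx] at hdvd1
      have h1 : d ((Fin.last j).castSucc) / d (if (i.castSucc : Fin (j + 2)) = Fin.last (j + 1) then ((Fin.last j).castSucc : Fin (j + 2))
          else i.castSucc) = 1 := Nat.dvd_one.1 hdvd1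
      rw [if_neg (hcs_ne i)] at h1
      obtain ⟨q, hq⟩ := h.dvd (i.castSucc) ((Fin.last j).castSucc) (Fin.castSucc_le_castSucc_iff.2 (Fin.le_last i))
      rw [hq, Nat.mul_div_cancel_left q (h.pos hη _)] at h1
      rw [hq, h1, mul_one]
    intro i
    rw [hone i, ← Fin.castSucc_zero, hone 0]
  · intro hd
    obtain ⟨b, hb⟩ := exists_basis_integralForms_coe_eq_latMonomial_complWord Φ e₀ hkl
    rw [h.map_wedge_integralForms_three_eq_closure_of_eq_content_smul Φ hη hkl hle₂ hγ]
    refine Eq.trans (congrArg AddSubgroup.closure (congrArg Set.range (funext fun x ↦ ?_))) (closure_range_coe_basis_eq b)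
    have h1 : d ((Fin.last j).castSucc) / d (if Sum.elim id id x = Fin.last (j + 1) then ((Fin.last j).castSucc : Fin (j + 2))
        else Sum.elim id id x) = 1 := by
      by_cases ha : Sum.elim id id x = Fin.last (j + 1)
      · rw [if_pos ha]
        exact Nat.div_self (h.pos hη _)
      · rw [if_neg ha, ← Fin.castSucc_castPred (Sum.elim id id x) ha]
        simp only [hd]
        exact Nat.div_self (h.pos hη _)
    rw [hb, h1, Nat.cast_one, one_zsmul]

/-! ## §3 Basis-free forms: any presentation of a polarised torus of type `(d₁, …, d_g)` -/

/-- **`H^{2g−1}(X, ℤ)/γ_{g−1} ∧ H¹(X, ℤ) ≃+ ⊕_x ℤ/(d_g/d_{a(x)})` for a Riemann form of type `(d₁, …, d_g)` on a torus presented by ANY lattice basis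
and any form `m` with `θ^{∧(g−1)} = ((g−1)!·d₁⋯d_{g−1}) · m`** (`g = j + 2`).
[cite: Lange2023AbelianVarietiesComplex, §5.4.1 Thm. 5.4.1 and (5.22) (PDF p. 275); §1.5.1 (PDF p. 51)] [cite: VoisinHodgeI2002, §7.2.2 (PDF p. 142 L10)] -/
theorem IsPolarizationType.nonempty_addEquiv_quotient_map_wedge_integralForms_one_of_eq_content_smul {Φ : (ι → ℝ) ≃L[ℝ] E}
    (hd : IsPolarizationType Φ η d) (hη : IsRiemannForm Φ η) (hle₁ : j + 1 ≤ j + 2) {m : E [⋀^Fin (2 * (j + 1))]→L[ℝ] ℂ}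
    (hm : wedgePow (ofRealForm η) (j + 1) = (((j + 1).factorial * ∏ i : Fin (j + 1), d (Fin.castLE hle₁ i) : ℕ) : ℂ) • m) :
    Nonempty (↥(integralForms Φ (2 * j + 3)) ⧸ ((integralForms Φ 1).map (AddMonoidHom.mk'
        (fun x : E [⋀^Fin 1]→L[ℝ] ℂ ↦ (m.wedge x : E [⋀^Fin (2 * j + 3)]→L[ℝ] ℂ))
        (ContinuousAlternatingMap.wedge_add_right _))).addSubgroupOf (integralForms Φ (2 * j + 3)) ≃+
      ((x : Fin (j + 2) ⊕ Fin (j + 2)) → ZMod (d (Fin.last (j + 1)) / d (Sum.elim id id x)))) := by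
  obtain ⟨Φ', hΛ, hs⟩ := hd.exists_isSymplecticEnum Φ
  rw [integralForms_eq_of_range_latticeVec_eq hΛ.symm 1, integralForms_eq_of_range_latticeVec_eq hΛ.symm (2 * j + 3)]
  exact hs.nonempty_addEquiv_quotient_map_wedge_integralForms_one_of_eq_content_smul Φ' (hη.of_range_latticeVec_subset hΛ.le) hle₁ hm

/-- **`γ_{g−1} ∧ H¹(X, ℤ) = H^{2g−1}(X, ℤ) ⟺ d₁ = ⋯ = d_g`, any presentation** (`g = j + 2`).
[cite: Lange2023AbelianVarietiesComplex, §5.4.1 Thm. 5.4.1 and (5.22) (PDF p. 275); §4.2 (PDF p. 204); §1.5.1 (PDF p. 51)] [cite: VoisinHodgeI2002, §7.2.2 (PDF p. 142 L10)] -/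
theorem IsPolarizationType.map_wedge_integralForms_one_eq_integralForms_iff_of_eq_content_smul {Φ : (ι → ℝ) ≃L[ℝ] E}
    (hd : IsPolarizationType Φ η d) (hη : IsRiemannForm Φ η) (hle₁ : j + 1 ≤ j + 2) {m : E [⋀^Fin (2 * (j + 1))]→L[ℝ] ℂ}
    (hm : wedgePow (ofRealForm η) (j + 1) = (((j + 1).factorial * ∏ i : Fin (j + 1), d (Fin.castLE hle₁ i) : ℕ) : ℂ) • m) :
    (integralForms Φ 1).map (AddMonoidHom.mk'
        (fun x : E [⋀^Fin 1]→L[ℝ] ℂ ↦ (m.wedge x : E [⋀^Fin (2 * j + 3)]→L[ℝ] ℂ))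
        (ContinuousAlternatingMap.wedge_add_right _)) = integralForms Φ (2 * j + 3) ↔ ∀ i, d i = d 0 := by
  obtain ⟨Φ', hΛ, hs⟩ := hd.exists_isSymplecticEnum Φ
  rw [integralForms_eq_of_range_latticeVec_eq hΛ.symm 1, integralForms_eq_of_range_latticeVec_eq hΛ.symm (2 * j + 3)]
  exact hs.map_wedge_integralForms_one_eq_integralForms_iff_of_eq_content_smul Φ' (hη.of_range_latticeVec_subset hΛ.le) hle₁ hm

/-- **`H^{2g−1}(X, ℤ)/γ_{g−2} ∧ H³(X, ℤ) ≃+ ⊕_x ℤ/(d_{g−1}/d_{min(a(x), g−1)})`, any presentation** (`g = j + 2`; `θ^{∧(g−2)} = ((g−2)!·d₁⋯d_{g−2}) · γ`).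
[cite: Lange2023AbelianVarietiesComplex, §5.4.1 Thm. 5.4.1 and (5.22) (PDF p. 275); §1.5.1 (PDF p. 51)] [cite: VoisinHodgeI2002, §7.1.2 (PDF p. 134 L31)] -/
theorem IsPolarizationType.nonempty_addEquiv_quotient_map_wedge_integralForms_three_of_eq_content_smul {Φ : (ι → ℝ) ≃L[ℝ] E}
    (hd : IsPolarizationType Φ η d) (hη : IsRiemannForm Φ η) (hle₂ : j ≤ j + 2) {γ : E [⋀^Fin (2 * j)]→L[ℝ] ℂ}
    (hγ : wedgePow (ofRealForm η) j = ((j.factorial * ∏ i : Fin j, d (Fin.castLE hle₂ i) : ℕ) : ℂ) • γ) :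
    Nonempty (↥(integralForms Φ (2 * j + 3)) ⧸ ((integralForms Φ 3).map (AddMonoidHom.mk'
        (fun x : E [⋀^Fin 3]→L[ℝ] ℂ ↦ γ.wedge x) (ContinuousAlternatingMap.wedge_add_right _))).addSubgroupOf (integralForms Φ (2 * j + 3)) ≃+
      ((x : Fin (j + 2) ⊕ Fin (j + 2)) → ZMod (d ((Fin.last j).castSucc) /
        d (if Sum.elim id id x = Fin.last (j + 1) then ((Fin.last j).castSucc : Fin (j + 2)) else Sum.elim id id x)))) := by
  obtain ⟨Φ', hΛ, hs⟩ := hd.exists_isSymplecticEnum Φ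
  rw [integralForms_eq_of_range_latticeVec_eq hΛ.symm 3, integralForms_eq_of_range_latticeVec_eq hΛ.symm (2 * j + 3)]
  exact hs.nonempty_addEquiv_quotient_map_wedge_integralForms_three_of_eq_content_smul Φ' (hη.of_range_latticeVec_subset hΛ.le) hle₂ hγ

/-- **`γ_{g−2} ∧ H³(X, ℤ) = H^{2g−1}(X, ℤ) ⟺ d₁ = ⋯ = d_{g−1}`, any presentation** (`g = j + 2`).
[cite: Lange2023AbelianVarietiesComplex, §5.4.1 Thm. 5.4.1 and (5.22) (PDF p. 275); §4.2 (PDF p. 204); §1.5.1 (PDF p. 51)] [cite: VoisinHodgeI2002, §7.1.2 (PDF p. 134 L31)] -/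
theorem IsPolarizationType.map_wedge_integralForms_three_eq_integralForms_iff_of_eq_content_smul {Φ : (ι → ℝ) ≃L[ℝ] E}
    (hd : IsPolarizationType Φ η d) (hη : IsRiemannForm Φ η) (hle₂ : j ≤ j + 2) {γ : E [⋀^Fin (2 * j)]→L[ℝ] ℂ}
    (hγ : wedgePow (ofRealForm η) j = ((j.factorial * ∏ i : Fin j, d (Fin.castLE hle₂ i) : ℕ) : ℂ) • γ) :
    (integralForms Φ 3).map (AddMonoidHom.mk'
        (fun x : E [⋀^Fin 3]→L[ℝ] ℂ ↦ γ.wedge x) (ContinuousAlternatingMap.wedge_add_right _)) = integralForms Φ (2 * j + 3) ↔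
      ∀ i : Fin (j + 1), d i.castSucc = d 0 := by
  obtain ⟨Φ', hΛ, hs⟩ := hd.exists_isSymplecticEnum Φ
  rw [integralForms_eq_of_range_latticeVec_eq hΛ.symm 3, integralForms_eq_of_range_latticeVec_eq hΛ.symm (2 * j + 3)]
  exact hs.map_wedge_integralForms_three_eq_integralForms_iff_of_eq_content_smul Φ' (hη.of_range_latticeVec_subset hΛ.le) hle₂ hγ

end CoLefschetzMinimalClass

end Literature.Geometry.Kaehler.ComplexTorus
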